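import Summits.NavierStokesRegularity.TurbBounds.LegendreCoeffs
import HarnessLib

/-!
# RB rows: the Legendre background profile `τ′ = −1 + (1/s)·Σ_{1≤p≤P} φ̂_p P_p(2z−1)` — admissibility `∫₀¹ τ′ = −1` and the value of the cited bound
(cell `pub-turb` / `turb-bounds`; v2 groundwork for the RB rows with `P > 0` (RB-N1′/N2′, RB-N1…): rbsdp SPEC §3 / CERT-RB §R parametrise the
background through the Legendre data `φ̂_1…φ̂_P` of `φ = s(τ′ + 1)` on `[0, 1]`; the cited reduction (`SpectralForm.SpectralReduction`) delivers
`Nu ≤ s∫₀¹τ′² − (s−1)`, which for this profile IS the CERTIFIED formula `1 + Σ_p φ̂_p²/((2p+1)s)` (`rb_bound_value`). Exact Legendre/Parseval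
arithmetic only (the tree's `LegendreCoeffs`); no certificate data. Written by pub-turb-cert, prover-pub-turb-cert-g6-0.)

HONEST FRAMING: rigorous bounds for the stated PDE and boundary conditions; no claim about physical turbulence beyond the bound.
-/

set_option linter.style.longLine false

noncomputable section

namespace Summit.NavierStokesRegularity.TurbBounds.RBProfile

open Polynomial intervalIntegral MeasureTheory Finset Literature.Analysis.SpecialFunctions
open Summit.NavierStokesRegularity.TurbBounds.LadderTail (w)
open Summit.NavierStokesRegularity.TurbBounds.LegendreCoeffs

/-- The profile fluctuation `φ = Σ_{p ≤ P} φ̂_p P_p` as a polynomial in the layer variable `x = 2z − 1` (the rows have `φ̂_0 = 0`). -/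
def phiPoly (P : ℕ) (φ : ℕ → ℝ) : ℝ[X] := ∑ p ∈ range (P + 1), C (φ p) * legendre p

/-- The RB background derivative `τ′(z) = −1 + (1/s)·φ(2z − 1)` with balance parameter `s` (so `φ = s(τ′ + 1)`). -/
def tauRB (s : ℝ) (P : ℕ) (φ : ℕ → ℝ) (z : ℝ) : ℝ := -1 + (1 / s) * (phiPoly P φ).eval (2 * z - 1)

/-- `τ′` is continuous. -/
theorem tauRB_continuous (s : ℝ) (P : ℕ) (φ : ℕ → ℝ) : Continuous (tauRB s P φ) := by
  unfold tauRB; fun_prop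

/-- `deg φ ≤ P`. -/
theorem natDegree_phiPoly_le (P : ℕ) (φ : ℕ → ℝ) : (phiPoly P φ).natDegree ≤ P := by
  unfold phiPoly
  refine natDegree_sum_le_of_forall_le _ _ (fun p hp => ?_)
  refine (natDegree_C_mul_le _ _).trans ?_
  rw [natDegree_legendre]
  rw [Finset.mem_range] at hp; omega

/-- The Legendre data of `φ` are the `φ̂`. -/
theorem legCoeff_phiPoly (P : ℕ) (φ : ℕ → ℝ) (p : ℕ) : legCoeff (phiPoly P φ) p = if p ≤ P then φ p else 0 := by
  unfold phiPoly; exact legCoeff_expansion P φ p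

/-- Parseval: `∫_{-1}^{1} φ² = Σ_{p ≤ P} w_p φ̂_p²`, `w_p = 2/(2p+1)`. -/
theorem integral_phiPoly_sq (P : ℕ) (φ : ℕ → ℝ) :
    ∫ x in (-1 : ℝ)..1, (phiPoly P φ).eval x ^ 2 = ∑ p ∈ range (P + 1), w p * φ p ^ 2 := by
  rw [integral_sq_eq_sum_of_lt (phiPoly P φ) (R := P + 1) (Nat.lt_succ_of_le (natDegree_phiPoly_le P φ))]
  refine sum_congr rfl fun p hp => ?_
  rw [legCoeff_phiPoly, if_pos (by rw [Finset.mem_range] at hp; omega)]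

/-- Mean zero: `∫_{-1}^{1} φ = 0` when `φ̂_0 = 0`. -/
theorem integral_phiPoly (P : ℕ) (φ : ℕ → ℝ) (h0 : φ 0 = 0) : ∫ x in (-1 : ℝ)..1, (phiPoly P φ).eval x = 0 := by
  have e : (∫ x in (-1 : ℝ)..1, (phiPoly P φ).eval x) = ∫ x in (-1 : ℝ)..1, (phiPoly P φ).eval x * (legendre 0).eval x :=
    intervalIntegral.integral_congr fun x _ => by rw [legendre_zero, eval_one, mul_one]
  rw [e, integral_mul_legendre_eq, legCoeff_phiPoly, if_pos (Nat.zero_le _), h0, mul_zero]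

/-- change of variables `x = 2z − 1`: `∫₀¹ f(2z − 1) dz = ½ ∫_{-1}^{1} f`. -/
theorem integral_comp_two_mul_sub_one (f : ℝ → ℝ) :
    ∫ z in (0 : ℝ)..1, f (2 * z - 1) = (1 / 2) * ∫ x in (-1 : ℝ)..1, f x := by
  rw [intervalIntegral.integral_comp_mul_sub f (by norm_num : (2 : ℝ) ≠ 0) 1]
  norm_num

/-- **Admissibility**: `∫₀¹ τ′ = −1` (the background drops from `τ(0) = 1` to `τ(1) = 0`), for `φ̂_0 = 0`. -/
theorem tauRB_total (s : ℝ) (P : ℕ) {φ : ℕ → ℝ} (h0 : φ 0 = 0) : ∫ z in (0 : ℝ)..1, tauRB s P φ z = -1 := by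
  unfold tauRB
  rw [intervalIntegral.integral_add intervalIntegrable_const ((Continuous.intervalIntegrable (by fun_prop) _ _)),
    intervalIntegral.integral_const_mul, integral_comp_two_mul_sub_one (fun x => (phiPoly P φ).eval x), integral_phiPoly P φ h0]
  simp

/-- **The cited bound's value on the Legendre profile**: `s·∫₀¹ τ′² − (s − 1) = 1 + (1/s)·Σ_{p ≤ P} φ̂_p²/(2p+1)` (= the CERTIFIED formula
`1 + Σ_p φ̂_p²/((2p+1)s)` of the RB rows), for `s ≠ 0` and `φ̂_0 = 0`. -/
theorem rb_bound_value {s : ℝ} (hs : s ≠ 0) (P : ℕ) {φ : ℕ → ℝ} (h0 : φ 0 = 0) :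
    s * (∫ z in (0 : ℝ)..1, tauRB s P φ z ^ 2) - (s - 1) = 1 + (1 / s) * ∑ p ∈ range (P + 1), φ p ^ 2 / (2 * p + 1) := by
  have hsq : ∀ z, tauRB s P φ z ^ 2
      = 1 + (-(2 / s)) * (phiPoly P φ).eval (2 * z - 1) + (1 / s ^ 2) * (phiPoly P φ).eval (2 * z - 1) ^ 2 := by
    intro z; unfold tauRB; ring
  simp_rw [hsq]
  have i1 : IntervalIntegrable (fun z : ℝ => (1 : ℝ)) volume 0 1 := intervalIntegrable_const
  have i2 : IntervalIntegrable (fun z : ℝ => (-(2 / s)) * (phiPoly P φ).eval (2 * z - 1)) volume 0 1 :=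
    Continuous.intervalIntegrable (by fun_prop) _ _
  have i3 : IntervalIntegrable (fun z : ℝ => (1 / s ^ 2) * (phiPoly P φ).eval (2 * z - 1) ^ 2) volume 0 1 :=
    Continuous.intervalIntegrable (by fun_prop) _ _
  rw [intervalIntegral.integral_add (i1.add i2) i3, intervalIntegral.integral_add i1 i2, intervalIntegral.integral_const_mul,
    intervalIntegral.integral_const_mul, integral_comp_two_mul_sub_one (fun x => (phiPoly P φ).eval x),
    integral_comp_two_mul_sub_one (fun x => (phiPoly P φ).eval x ^ 2), integral_phiPoly P φ h0, integral_phiPoly_sq]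
  simp only [intervalIntegral.integral_const, sub_zero, smul_eq_mul, mul_one, mul_zero, add_zero]
  have key : (1 / s ^ 2) * ((1 / 2) * ∑ p ∈ range (P + 1), w p * φ p ^ 2) = (1 / s) * ((1 / s) * ∑ p ∈ range (P + 1), φ p ^ 2 / (2 * p + 1)) := by
    simp only [mul_sum]
    refine sum_congr rfl fun p _ => ?_
    rw [LegendreCoeffs.w_eq]
    field_simp
  rw [key]
  field_simp
  ring

end Summit.NavierStokesRegularity.TurbBounds.RBProfile

end
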